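import Summits.FinalStateConjecture.FinalStateConjecture.Theses.BurnettKineticRigidity
import Literature.Geometry.Lorentzian.AdmissibleMGHDExistence
import Literature.Geometry.Lorentzian.ChainUnionDevelopment
import Literature.Geometry.Lorentzian.MCGHDNoCorrespondingBoundary
import Literature.Geometry.Lorentzian.DataEmbeddingNormalSmooth

/-!
# Route BurnettKineticRigidity · item `MGHDExistence` (stmt-FinalStateConjecture-9990) —
# conditional closure, and the item reduced to the displayed inputs of the printed proofs

The route decl
`Summit.FinalStateConjecture.FinalStateConjecture.Theses.BurnettKineticRigidity.MGHDExistence`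
(the anti-vacuity conjunct of the Statement, shared with route LambdaRegulator and — under the
names `MGHDExists` / `AdmissibleMGHDExists` / `MaximalDevelopmentExists` — with the other routes of
summit `FinalStateConjecture`) reads: for every connected, Hausdorff, second countable smooth
`3`-manifold `X` and every Christodoulou-admissible vacuum datum `D ∈ admissibleVacuumData X` there
is a maximal vacuum Cauchy development `𝒟 : VacuumCauchyDevelopment D`, `𝒟.IsMaximal`
(Choquet-Bruhat–Geroch, Comm. Math. Phys. 14 (1969), Thm. 3, p. 332; Sbierski, Ann. Henri
Poincaré 17 (2016), Thm. 2.8; Ringström 2009, Thm. 16.6).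

As a proposition it is, verbatim, the named fact
`Literature.Geometry.Lorentzian.choquetBruhat_geroch_exists_mghd_cauchy`
(`CauchyProblemMGHDExistence.lean`) restricted to the admissible class
(`choquetBruhat_geroch_exists_mghd_cauchy.forall_mem_admissibleVacuumData`,
`AdmissibleMGHDExistence.lean`). That fact is undischarged; the tree reduces it
(`CauchyProblemMGHDExistenceProofs`, `ChainUnionDevelopment`, `MaximalCommonDevelopment`,
`DevelopmentGluing*`, `MCGHDNoCorrespondingBoundary`, `CauchyProblemLocalUniquenessProofs`) to the
quasilinear hyperbolic PDE theory of the vacuum Einstein equations in wave gauge (local existence,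
local geometric uniqueness) plus Sbierski's Theorem 12. This file records, for THIS route's decl:

* `mghdExistence_of_choquetBruhatGeroch` — the CONDITIONAL closure of the item from the named
  fact (trust base: Choquet-Bruhat–Geroch 1969, Thm. 3);
* `mghdExistence_iff_localExistence_and_common_extension` — over the prelude the item is
  EQUIVALENT to the conjunction, on admissible data, of (i) local existence (some vacuum Cauchy
  development exists; Choquet-Bruhat 1952 = Choquet-Bruhat–Geroch Thm. 1) and (ii) common
  extensions (any two vacuum Cauchy developments embed into a common one; Sbierski 2016, Thm. 2.7):
  the chains-bounded input of the Zorn frame is a theorem of the tree given one development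
  (`VacuumCauchyDevelopment.exists_isMaximal_of_nonempty_of_common_extension`, union of chains);
* `mghdExistence_of_localExistence_of_localTheory_of_thm12` — the item from THREE displayed
  inputs on admissible data: (1) local existence, (2) local theory in the realised shape (any two
  vacuum Cauchy developments have a common globally hyperbolic development `U ⊆ M`,
  `CauchyDevelopment.IsCommonDevelopment`; Sbierski 2016, Thm. 2.4 (ii)), (3) Sbierski 2016,
  Thm. 3.5 = arXiv Thm. 12 (a common development with corresponding boundary points is strictly
  contained in a larger one) — the gluing along the maximal common development being the tree's
  `choquetBruhat_geroch_common_extension_of_localTheory_of_exists_lt`;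
So an unconditional proof of the item owes exactly: local existence for admissible data (no
registered fact over the repaired structure `VacuumCauchyDevelopment`; the deprecated
`choquetBruhat_local_existence` ranges over the uninhabited `VacuumDevelopment`), the local theory
(in the tree the registered fact `hawkingEllis_locallyUnique_vacuumDevelopment`,
`CauchyProblemLocalUniqueness.lean`, realised inside the first development as in route
SwallowTheDatum's `SubdataDevelopmentsEmbed.exists_isCommonDevelopment_of_locallyUnique`), and
Theorem 12. No definition is introduced; nothing is restated; no named
fact is added (inputs are hypotheses of theorems, D-0026).
-/

noncomputable section

open scoped Manifold ContDiff
open TopologicalSpace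

-- `Summit.FinalStateConjecture.FinalStateConjecture.…`: summit = sub-problem name (D-0017), as in every file here;
-- the Summits library sets `weak.linter.dupNamespace = false`, repeated for standalone elaboration (`lean check`).
set_option linter.dupNamespace false

namespace Summit.FinalStateConjecture.FinalStateConjecture.Theorems

open Literature.Geometry.Lorentzian

/-- **Conditional closure of item `MGHDExistence` (stmt-FinalStateConjecture-9990).** Under the
named fact `choquetBruhat_geroch_exists_mghd_cauchy` (Choquet-Bruhat–Geroch 1969, Thm. 3: every
smooth solution of the vacuum constraints on a connected Hausdorff second countable `3`-manifold
has a maximal vacuum Cauchy development), every admissible vacuum datum has a maximal vacuum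
Cauchy development — the route decl `BurnettKineticRigidity.MGHDExistence`. One line over the tree
corollary `choquetBruhat_geroch_exists_mghd_cauchy.exists_isMaximal_of_mem_admissibleVacuumData`
(Levi-Civita instance by `PseudoRiemannianMetric.hasLeviCivita`, constraint hypothesis by
`isVacuumConstraintSolution_of_mem_admissibleVacuumData`). CONDITIONAL: trust base = the
undischarged fact. [cite: ChoquetBruhatGeroch1969CMP, Thm. 3 (p. 332)] -/
theorem mghdExistence_of_choquetBruhatGeroch (h : choquetBruhat_geroch_exists_mghd_cauchy) :
    Summit.FinalStateConjecture.FinalStateConjecture.Theses.BurnettKineticRigidity.MGHDExistence := by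
  unfold Theses.BurnettKineticRigidity.MGHDExistence
  intro X _ _ _ _ _ _ D hD
  exact h.exists_isMaximal_of_mem_admissibleVacuumData hD

/-- **Item `MGHDExistence` is equivalent, over the prelude, to local existence plus common
extensions on the admissible class.** Forward: a maximal vacuum Cauchy development is a
development, and is a common extension of any two (`IsMaximal.common_extension`, "Theorem 2.8
clearly implies Theorem 2.7", Sbierski 2016). Backward: the Zorn frame of Choquet-Bruhat–Geroch's
proof of Theorem 3 with its chains-bounded input discharged by the union of chains
(`VacuumCauchyDevelopment.exists_isMaximal_of_nonempty_of_common_extension`,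
`ChainUnionDevelopment`). [cite: ChoquetBruhatGeroch1969CMP, Thm. 3 and its proof (pp. 332–334)]
[cite: Sbierski2016AHP, Thm. 2.7–2.8] -/
theorem mghdExistence_iff_localExistence_and_common_extension :
    Summit.FinalStateConjecture.FinalStateConjecture.Theses.BurnettKineticRigidity.MGHDExistence ↔
      (∀ (X : Type) [TopologicalSpace X] [ChartedSpace E3 X] [IsManifold (𝓡 3) ∞ X]
        [T2Space X] [SecondCountableTopology X] [ConnectedSpace X] (D : InitialDataSet (𝓡 3) X),
        D ∈ admissibleVacuumData X → Nonempty (VacuumCauchyDevelopment D)) ∧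
      (∀ (X : Type) [TopologicalSpace X] [ChartedSpace E3 X] [IsManifold (𝓡 3) ∞ X]
        [T2Space X] [SecondCountableTopology X] [ConnectedSpace X] (D : InitialDataSet (𝓡 3) X),
        D ∈ admissibleVacuumData X → ∀ 𝒟₁ 𝒟₂ : VacuumCauchyDevelopment D,
          ∃ 𝒟₃ : VacuumCauchyDevelopment D,
            𝒟₁.toCauchyDevelopment.EmbedsInto 𝒟₃.toCauchyDevelopment ∧
              𝒟₂.toCauchyDevelopment.EmbedsInto 𝒟₃.toCauchyDevelopment) := by
  unfold Theses.BurnettKineticRigidity.MGHDExistence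
  constructor
  · intro h
    refine ⟨fun X _ _ _ _ _ _ D hD ↦ ?_, fun X _ _ _ _ _ _ D hD 𝒟₁ 𝒟₂ ↦ ?_⟩
    · obtain ⟨𝒟, -⟩ := h X D hD
      exact ⟨𝒟⟩
    · obtain ⟨𝒟, h𝒟⟩ := h X D hD
      exact h𝒟.common_extension 𝒟₁ 𝒟₂
  · rintro ⟨hex, hce⟩ X _ _ _ _ _ _ D hD
    exact VacuumCauchyDevelopment.exists_isMaximal_of_nonempty_of_common_extension (hex X D hD)
      (hce X D hD)

/-- **Item `MGHDExistence` from "local existence", "local theory" (Sbierski 2016, Thm. 2.4) and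
"NotMCGHD" (Sbierski 2016, Thm. 3.5 = arXiv Thm. 12), all restricted to admissible data.** For each
admissible datum `D`: the Zorn frame with the chains-bounded input discharged by the union of
chains (`mghdExistence_iff_localExistence_and_common_extension`, backward), fed with the
common extension produced by gluing along the maximal common globally hyperbolic development
(`choquetBruhat_geroch_common_extension_of_localTheory_of_exists_lt`, whose displayed
differentiability hypothesis on unit normals is the theorem
`DataEmbedding.mdifferentiableAt_embed_normal`). [cite: Sbierski2016AHP, §3.3, proof of Thm. 2.8 from Thm. 2.4, Thm. 3.5]
[cite: ChoquetBruhatGeroch1969CMP, Thm. 3 and its proof (pp. 332–334)] -/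
theorem mghdExistence_of_localExistence_of_localTheory_of_thm12
    (hex : ∀ (X : Type) [TopologicalSpace X] [ChartedSpace E3 X] [IsManifold (𝓡 3) ∞ X]
      [T2Space X] [SecondCountableTopology X] [ConnectedSpace X] (D : InitialDataSet (𝓡 3) X),
      D ∈ admissibleVacuumData X → Nonempty (VacuumCauchyDevelopment D))
    (hlocal : ∀ (X : Type) [TopologicalSpace X] [ChartedSpace E3 X] [IsManifold (𝓡 3) ∞ X]
      [T2Space X] [SecondCountableTopology X] [ConnectedSpace X] (D : InitialDataSet (𝓡 3) X),
      D ∈ admissibleVacuumData X → ∀ 𝒟 𝒟' : VacuumCauchyDevelopment D,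
        ∃ U : Opens 𝒟.carrier, 𝒟.toCauchyDevelopment.IsCommonDevelopment 𝒟'.toDataEmbedding U)
    (h12 : ∀ (X : Type) [TopologicalSpace X] [ChartedSpace E3 X] [IsManifold (𝓡 3) ∞ X]
      [T2Space X] [SecondCountableTopology X] [ConnectedSpace X] (D : InitialDataSet (𝓡 3) X),
      D ∈ admissibleVacuumData X → ∀ (𝒟 𝒟' : VacuumCauchyDevelopment D)
        (𝔠 : CauchyDevelopment.CommonDevelopment 𝒟.toCauchyDevelopment 𝒟'.toCauchyDevelopment),
        𝔠.HasCorrespondingBoundaryPoints →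
          ∃ V : Opens 𝒟.carrier,
            𝒟.toCauchyDevelopment.IsCommonDevelopment 𝒟'.toDataEmbedding V ∧ 𝔠.opens < V) :
    Summit.FinalStateConjecture.FinalStateConjecture.Theses.BurnettKineticRigidity.MGHDExistence :=
  mghdExistence_iff_localExistence_and_common_extension.2 ⟨hex, fun X _ _ _ _ _ _ D hD ↦
    choquetBruhat_geroch_common_extension_of_localTheory_of_exists_lt (hlocal X D hD) (h12 X D hD)
      fun 𝒟 x ↦ 𝒟.toDataEmbedding.mdifferentiableAt_embed_normal x⟩

end Summit.FinalStateConjecture.FinalStateConjecture.Theorems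

end
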